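import Mathlib
import Literature.AlgebraicGeometry.Resolution.TranscendenceDefect
import Literature.AlgebraicGeometry.Resolution.FiniteExtensionUniformizationProofs
import Summits.ResolutionOfSingularities.ResolutionOfSingularities.Theorems.AbhyankarShadowsShadowsUniformizeResidueGen
import Summits.ResolutionOfSingularities.ResolutionOfSingularities.Theorems.AbhyankarShadowsSemivaluationShadowsQfgRankOne
import HarnessLib

/-!
# Route `RadicialJung`, crux `CleanModels` (stmt-15917), line `Sketch` rev 35, stub 7 `stub_cleanModelsDimGEFour`: Abhyankar places under a finitely
# generated extension of the ground field — transcendence defect and residue field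

Explicit-unit seat `decomp-res-hand-2` g3 (structural hand, stubs 5–7).  OURS; nothing here proves resolution in characteristic `p`.

`…LocalMonomializationGroundFieldDescent.lean` (this seat) reduces the «Abhyankar with inseparable residue field» corner of the local-uniformization
input of stub 7 to Knaf–Kuhlmann 2005 Thm. 1.1 (general form) over a SUBFIELD `k₀ ⊆ k` with `k/k₀` finitely generated, under two hypotheses stated
over `k₀`: `O` is Abhyankar over `k₀`, and `κ(O)/k₀` is separably generated.  This file derives both from the `k`-data (so that the corner is
reduced to print for every ground field finitely generated over a PERFECT field):

* `transcendenceDefect_eq_zero_of_tower` — for fields `k₀ → k → K` with `k/k₀` and `K/k` finitely generated and a valuation ring `O ⊇ k` of `K`: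
  Abhyankar over `k` ⟹ Abhyankar over `k₀` (`tr.deg` and the residual transcendence degree both grow by `tr.deg k/k₀`: `trdeg_add_eq`;
  the rational rank does not see the ground field).
* `residueField_adjoin_eq_top_of_transcendenceDefect_eq_zero` — at an Abhyankar place of a finitely generated `K/k` the residue field is finitely
  generated over `k` (Knaf–Kuhlmann 2005, Cor. 2.2 = ✓ `KnafKuhlmann2005_Cor22_holds`, through ✓ `isAbhyankarPlace_top_of_transcendenceDefect_eq_zero`
  and ✓ `resField_top_eq_top`), in the vocabulary `IntermediateField.adjoin k t = ⊤` for the algebra structure `k → O → κ(O)`.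
* `exists_sepGen_residueField_of_perfect_subfield` — hence, for `k = k₀(T)` with `k₀` PERFECT, `κ(O)` is finitely generated over `k₀` and so
  separably generated over `k₀` (Mathlib `exists_isTranscendenceBasis_and_isSeparable_of_perfectField`), in the exact hypothesis shape of
  `localMonomialization_at_abhyankarPlace_of_subfield` / `KnafKuhlmann2005_Thm11_monomialFormSepGen`.

Structural bookkeeping (valuation-theoretic plumbing), counted 0.
-/

noncomputable section

set_option linter.dupNamespace false -- mandated namespace of this single-conjunct summit

open IsLocalRing Cardinal
open Literature.AlgebraicGeometry.Resolution

namespace Summit.ResolutionOfSingularities.ResolutionOfSingularities.Theorems.RadicialJung.CleanModels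

/-! ## The transcendence defect along a finitely generated extension of the ground field -/

/-- **Abhyankar over `k` ⟹ Abhyankar over `k₀`** for fields `k₀ → k → K` with `k/k₀` and `K/k` finitely generated and a valuation ring `O` of
`K` containing `k`: `tr.deg(K/k₀) = tr.deg(k/k₀) + tr.deg(K/k)` and `tr.deg(κ(O)/k₀) = tr.deg(k/k₀) + tr.deg(κ(O)/k)` (towers), while the
rational rank is independent of the ground field, so `E + F = N` over `k` gives `E + F = N` over `k₀`. [cite: Temkin2013, Section 2.1 (p. 10)] -/
theorem transcendenceDefect_eq_zero_of_tower (k₀ k K : Type) [Field k₀] [Field k] [Field K]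
    [Algebra k₀ k] [Algebra k K] [Algebra k₀ K] [IsScalarTower k₀ k K]
    (hk₀fg : (⊤ : IntermediateField k₀ k).FG) (hKfg : (⊤ : IntermediateField k K).FG)
    (O : ValuationSubring K) (hk : ∀ c : k, algebraMap k K c ∈ O) (hk₀ : ∀ c : k₀, algebraMap k₀ K c ∈ O)
    (htd : transcendenceDefect k O hk = 0) : transcendenceDefect k₀ O hk₀ = 0 := by
  have hN : Algebra.trdeg k K < ℵ₀ := trdeg_lt_aleph0_of_fg hKfg
  have hNk : Algebra.trdeg k₀ k < ℵ₀ := trdeg_lt_aleph0_of_fg hk₀fg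
  haveI : FaithfulSMul k₀ k := (faithfulSMul_iff_algebraMap_injective k₀ k).mpr (algebraMap k₀ k).injective
  haveI : FaithfulSMul k K := (faithfulSMul_iff_algebraMap_injective k K).mpr (algebraMap k K).injective
  have htower : Algebra.trdeg k₀ K = Algebra.trdeg k₀ k + Algebra.trdeg k K := (trdeg_add_eq k₀ k).symm
  have hN₀ : Algebra.trdeg k₀ K < ℵ₀ := by
    rw [htower]
    exact Cardinal.add_lt_aleph0 hNk hN
  have h1 : ratRank O + residueTrdeg k O hk = Algebra.trdeg k K := (transcendenceDefect_eq_zero_iff O hk hN).mp htd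
  refine (transcendenceDefect_eq_zero_iff O hk₀ hN₀).mpr ?_
  -- the residual transcendence degree along the tower `k₀ → k → κ(O)`
  letI i₀ : Algebra k₀ O := algebraOfMem k₀ O hk₀
  letI i : Algebra k O := algebraOfMem k O hk
  haveI : IsScalarTower k₀ k (ResidueField O) := IsScalarTower.of_algebraMap_eq fun c => by
    rw [IsScalarTower.algebraMap_apply k₀ O (ResidueField O), IsScalarTower.algebraMap_apply k O (ResidueField O)]
    congr 1
    exact Subtype.ext (IsScalarTower.algebraMap_apply k₀ k K c)
  haveI : FaithfulSMul k (ResidueField O) :=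
    (faithfulSMul_iff_algebraMap_injective k (ResidueField O)).mpr (algebraMap k (ResidueField O)).injective
  have hres : residueTrdeg k₀ O hk₀ = Algebra.trdeg k₀ k + residueTrdeg k O hk := by
    show Algebra.trdeg k₀ (ResidueField O) = Algebra.trdeg k₀ k + Algebra.trdeg k (ResidueField O)
    exact (trdeg_add_eq k₀ k).symm
  rw [hres, htower, ← h1]
  exact add_left_comm _ _ _

/-! ## The residue field of an Abhyankar place is finitely generated (Cor. 2.2), `k → O → κ(O)` vocabulary -/

/-- **Knaf–Kuhlmann 2005, Cor. 2.2 (residue part), in the `k`/`K` vocabulary**: for `K/k` finitely generated and a valuation ring `O ⊇ k` of `K`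
with transcendence defect `0`, the residue field `κ(O)` is generated over `k` (structure `k → O → κ(O)`) by finitely many elements.  From
✓ `KnafKuhlmann2005_Cor22_holds` (ambient form) through ✓ `isAbhyankarPlace_top_of_transcendenceDefect_eq_zero` and ✓ `resField_top_eq_top`.
[cite: KnafKuhlmann2005, Cor. 2.2] -/
theorem residueField_adjoin_eq_top_of_transcendenceDefect_eq_zero (k K : Type) [Field k] [Field K] [Algebra k K]
    (hKfg : (⊤ : IntermediateField k K).FG) (O : ValuationSubring K) (hk : ∀ c : k, algebraMap k K c ∈ O)
    (htd : transcendenceDefect k O hk = 0) :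
    letI : Algebra k (ResidueField O) := ((IsLocalRing.residue O).comp ((algebraMap k K).codRestrict O hk)).toAlgebra
    ∃ t : Finset (ResidueField O), IntermediateField.adjoin k (t : Set (ResidueField O)) = ⊤ := by
  letI : Algebra k (ResidueField O) := ((IsLocalRing.residue O).comp ((algebraMap k K).codRestrict O hk)).toAlgebra
  have hA := Summit.ResolutionOfSingularities.ResolutionOfSingularities.Theorems.isAbhyankarPlace_top_of_transcendenceDefect_eq_zero
    hKfg O hk htd
  have hfg₀ : FGOver (algebraMap k K).fieldRange (⊤ : Subfield K) := by
    obtain ⟨s, hs⟩ := hKfg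
    refine ⟨s, ?_⟩
    rw [← Summit.ResolutionOfSingularities.ResolutionOfSingularities.Theorems.toSubfield_adjoin_eq_closure, hs]
    rfl
  obtain ⟨-, t, ht⟩ := KnafKuhlmann2005_Cor22_holds K O (algebraMap k K).fieldRange ⊤ le_top hfg₀ hA
  rw [Summit.ResolutionOfSingularities.ResolutionOfSingularities.Theorems.resField_top_eq_top] at ht
  refine ⟨t, ?_⟩
  have hle : Subfield.closure ((resField O (algebraMap k K).fieldRange : Set (ResidueField O)) ∪ (t : Set (ResidueField O))) ≤
      (IntermediateField.adjoin k (t : Set (ResidueField O))).toSubfield := by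
    rw [Subfield.closure_le]
    rintro r (hr | hr)
    · obtain ⟨a, ha, rfl⟩ := (mem_resField_iff O _ r).mp hr
      obtain ⟨c, hc⟩ := RingHom.mem_fieldRange.mp ha
      have hac : residue O a = algebraMap k (ResidueField O) c := by
        change residue O a = residue O ⟨algebraMap k K c, hk c⟩
        congr 1
        exact Subtype.ext hc.symm
      rw [hac]
      exact IntermediateField.algebraMap_mem _ c
    · exact IntermediateField.subset_adjoin _ _ hr
  refine le_antisymm le_top fun r _ => ?_
  exact hle (ht.symm ▸ Subfield.mem_top r)

/-! ## Separable generation over a perfect subfield of the ground field -/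

/-- **Separable generation of the residue field over a perfect subfield `k₀` of the ground field.**  Let `k₀ → k → K` be fields with `k₀` PERFECT,
`k = k₀(T)` finitely generated over `k₀`, `K/k` finitely generated, `O ⊇ k` a valuation ring of `K` with transcendence defect `0` over `k`.  Then
`κ(O)` is finitely generated over `k₀` (Cor. 2.2 over `k`, plus the images of `T`), hence admits a finite separating transcendence basis over
`k₀` (Mathlib `exists_isTranscendenceBasis_and_isSeparable_of_perfectField`) — the residue hypothesis of `KnafKuhlmann2005_Thm11_monomialFormSepGen`
over `k₀`, for the structure `k₀ → O → κ(O)`. [cite: KnafKuhlmann2005, Cor. 2.2] -/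
theorem exists_sepGen_residueField_of_perfect_subfield (k₀ k K : Type) [Field k₀] [PerfectField k₀] [Field k] [Field K]
    [Algebra k₀ k] [Algebra k K] [Algebra k₀ K] [IsScalarTower k₀ k K]
    (T : Finset k) (hT : IntermediateField.adjoin k₀ (T : Set k) = ⊤)
    (hKfg : (⊤ : IntermediateField k K).FG)
    (O : ValuationSubring K) (hk : ∀ c : k, algebraMap k K c ∈ O) (hk₀ : ∀ c : k₀, algebraMap k₀ K c ∈ O)
    (htd : transcendenceDefect k O hk = 0) :
    letI : Algebra k₀ (ResidueField O) := ((IsLocalRing.residue O).comp ((algebraMap k₀ K).codRestrict O hk₀)).toAlgebra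
    ∃ s : Finset (ResidueField O), IsTranscendenceBasis k₀ ((↑) : s → ResidueField O) ∧
      Algebra.IsSeparable (IntermediateField.adjoin k₀ (s : Set (ResidueField O))) (ResidueField O) := by
  classical
  letI iκ : Algebra k (ResidueField O) := ((IsLocalRing.residue O).comp ((algebraMap k K).codRestrict O hk)).toAlgebra
  letI iκ₀ : Algebra k₀ (ResidueField O) := ((IsLocalRing.residue O).comp ((algebraMap k₀ K).codRestrict O hk₀)).toAlgebra
  haveI : IsScalarTower k₀ k (ResidueField O) := IsScalarTower.of_algebraMap_eq fun c => by
    change residue O ⟨algebraMap k₀ K c, hk₀ c⟩ = residue O ⟨algebraMap k K (algebraMap k₀ k c), hk _⟩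
    congr 1
    exact Subtype.ext (IsScalarTower.algebraMap_apply k₀ k K c)
  obtain ⟨t, ht⟩ := residueField_adjoin_eq_top_of_transcendenceDefect_eq_zero k K hKfg O hk htd
  -- `κ(O)` is finitely generated over `k₀`: generators `t` and the images of `T`
  let T' : Finset (ResidueField O) := T.image (algebraMap k (ResidueField O))
  have hfg₀ : (⊤ : IntermediateField k₀ (ResidueField O)).FG := by
    refine ⟨T' ∪ t, le_antisymm le_top ?_⟩
    have hrange : Set.range (algebraMap k (ResidueField O)) ⊆
        (IntermediateField.adjoin k₀ (↑(T' ∪ t) : Set (ResidueField O)) : Set (ResidueField O)) := by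
      rintro _ ⟨c, rfl⟩
      have hc : c ∈ IntermediateField.adjoin k₀ (T : Set k) := by
        rw [hT]
        exact IntermediateField.mem_top
      obtain ⟨r, hr, s, hs, rfl⟩ := IntermediateField.mem_adjoin_iff_div.mp hc
      have hpoly : ∀ q ∈ Algebra.adjoin k₀ (T : Set k),
          algebraMap k (ResidueField O) q ∈ IntermediateField.adjoin k₀ (↑(T' ∪ t) : Set (ResidueField O)) := by
        intro q hq
        induction hq using Algebra.adjoin_induction with
        | mem x hx =>
          refine IntermediateField.subset_adjoin _ _ ?_
          rw [Finset.coe_union, Finset.coe_image]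
          exact Or.inl ⟨x, hx, rfl⟩
        | algebraMap c =>
          rw [← IsScalarTower.algebraMap_apply]
          exact IntermediateField.algebraMap_mem _ c
        | add x y _ _ hx hy =>
          rw [map_add]
          exact add_mem hx hy
        | mul x y _ _ hx hy =>
          rw [map_mul]
          exact mul_mem hx hy
      rw [map_div₀]
      exact div_mem (hpoly r hr) (hpoly s hs)
    intro x _
    have hx : x ∈ (⊤ : IntermediateField k (ResidueField O)) := IntermediateField.mem_top
    rw [← ht] at hx
    change x ∈ (IntermediateField.adjoin k (t : Set (ResidueField O))).toSubfield at hx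
    rw [IntermediateField.adjoin_toSubfield] at hx
    refine (Subfield.closure_le (t := (IntermediateField.adjoin k₀ (↑(T' ∪ t) : Set (ResidueField O))).toSubfield)).mpr ?_ hx
    refine Set.union_subset hrange fun y hy => IntermediateField.subset_adjoin _ _ ?_
    rw [Finset.coe_union]
    exact Or.inr hy
  haveI : Algebra.EssFiniteType k₀ (ResidueField O) := IntermediateField.fg_top_iff.mp hfg₀
  exact exists_isTranscendenceBasis_and_isSeparable_of_perfectField k₀ (ResidueField O)

end Summit.ResolutionOfSingularities.ResolutionOfSingularities.Theorems.RadicialJung.CleanModels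

end
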